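import Mathlib
import Summits.Ventures.PercRepro2.HCovTyped
import Summits.Ventures.PercRepro2.TypedSpectator

/-!
# The typed bases of row 2′TRI with the colouring of the typed edges at `o` fixed — the statement
(TRI-o) (blind cell PercRepro2, typer-1 g44, 2026-08-27; night-3 g15's candidate of STATUS 7700,
typed on its ask — NOTHING here is claimed proved beyond the bookkeeping)

* `symKer K = (1/6) Σ_π K ∘ π`, the `S₃`-symmetrisation of a three-copy kernel; it is invisible to
  the typed count (`typedCount_symKer`: the six copy permutations fix `typedCount` for types in
  `{1, 2}`, `TypedSpectator.typedCount_swap12/23/13`).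
* `typedClassCount F z τ S x₀ y₀ w₀ K`, the **class sum**: the typed count restricted to the typed
  triples agreeing with the colouring `(x₀, y₀, w₀)` on the edges of `S`.  The classes of the
  colourings of `S` (padded by `false` off `S`) partition the typed triples
  (`typedCount_eq_sum_typedClassCount`); with `S = ∅` the class sum is the typed count
  (`typedClassCount_empty`).  The one-edge split of a class and the behaviour of class sums under
  the copy permutations (the class sum of the symmetrised kernel = the average of the raw class
  sums over the six colour permutations) are in `TypedClassCountAPI.lean`.
* **`TypedBasesO ends o a₁ a₂ a₃ b`** = (TRI-o): for every instance `(F, z, τ)` with types in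
  `{1, 2}` and every colouring of the typed edges at `o` (`F.filter (o ∈ ends e)`), the class sum of
  the symmetrised kernel `symKer K₃` is nonnegative.  It strengthens row 2′TRI:
  `TypedBases_of_typedBasesO : TypedBasesO … → TypedBases …` (sum the classes, drop the
  symmetrisation).  Census (night-3 g15, own code, STATUS 7700): `a ≤ 5` exhaustive on the abstract
  merge model, every colouring of the `o`-star, 0 negative classes; the same conditioning at any
  other mark fails.  Own work; standard axioms.
-/

namespace Summit.Ventures.PercRepro2

namespace CovForm

/-! ## The symmetrised kernel and the typed count -/

section Sym

variable {E : Type*} [Fintype E] [DecidableEq E] {R : Type*} [Field R]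

/-- The `S₃`-symmetrisation of a three-copy kernel: `(1/6) Σ_π K ∘ π`. -/
noncomputable def symKer (K : Config E → Config E → Config E → R) :
    Config E → Config E → Config E → R :=
  fun x y w => (6 : R)⁻¹ * (K x y w + K x w y + K y x w + K y w x + K w x y + K w y x)

omit [Fintype E] [DecidableEq E] in
/-- The symmetrised kernel is symmetric in the first two copies. -/
lemma symKer_swap12 (K : Config E → Config E → Config E → R) (x y w : Config E) :
    symKer K y x w = symKer K x y w := by
  unfold symKer; ring

omit [Fintype E] [DecidableEq E] in
/-- The symmetrised kernel is symmetric in the last two copies. -/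
lemma symKer_swap23 (K : Config E → Config E → Config E → R) (x y w : Config E) :
    symKer K x w y = symKer K x y w := by
  unfold symKer; ring

/-- The typed count of a constant multiple of a kernel. -/
lemma typedCount_const_mul' (F : Finset E) (z : Config E) (τ : E → ℕ) (c : R)
    (K : Config E → Config E → Config E → R) :
    typedCount F z τ (fun x y w => c * K x y w) = c * typedCount F z τ K := by
  unfold typedCount
  simp only [Finset.mul_sum]
  refine Finset.sum_congr rfl fun x _ => Finset.sum_congr rfl fun y _ =>
    Finset.sum_congr rfl fun w _ => ?_
  split_ifs <;> simp

/-- The typed count of a sum of six kernels. -/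
lemma typedCount_sum6 (F : Finset E) (z : Config E) (τ : E → ℕ)
    (K₁ K₂ K₃ K₄ K₅ K₆ : Config E → Config E → Config E → R) :
    typedCount F z τ (fun x y w =>
        K₁ x y w + K₂ x y w + K₃ x y w + K₄ x y w + K₅ x y w + K₆ x y w) =
      typedCount F z τ K₁ + typedCount F z τ K₂ + typedCount F z τ K₃ + typedCount F z τ K₄ +
        typedCount F z τ K₅ + typedCount F z τ K₆ := by
  unfold typedCount
  simp only [← Finset.sum_add_distrib]
  refine Finset.sum_congr rfl fun x _ => Finset.sum_congr rfl fun y _ =>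
    Finset.sum_congr rfl fun w _ => ?_
  split_ifs <;> simp

/-- The typed count is invariant under the copy 3-cycle `(x, y, w) ↦ (y, w, x)` (types in
`{1, 2}`). -/
lemma typedCount_cyc (F : Finset E) (z : Config E) (τ : E → ℕ)
    (hτ : ∀ e ∈ F, τ e = 1 ∨ τ e = 2) (K : Config E → Config E → Config E → R) :
    typedCount F z τ (fun x y w => K y w x) = typedCount F z τ K := by
  have h1 := TypedA3.typedCount_swap12 F z τ (fun x y w => K x w y)
  have h2 := TypedA3.typedCount_swap23 F z τ hτ K
  exact h1.trans h2

/-- The typed count is invariant under the copy 3-cycle `(x, y, w) ↦ (w, x, y)` (types in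
`{1, 2}`). -/
lemma typedCount_cyc' (F : Finset E) (z : Config E) (τ : E → ℕ)
    (hτ : ∀ e ∈ F, τ e = 1 ∨ τ e = 2) (K : Config E → Config E → Config E → R) :
    typedCount F z τ (fun x y w => K w x y) = typedCount F z τ K := by
  have h1 := TypedA3.typedCount_swap13 F z τ hτ (fun x y w => K x w y)
  have h2 := TypedA3.typedCount_swap23 F z τ hτ K
  exact h1.trans h2

/-- **The symmetrisation is invisible to the typed count** (types in `{1, 2}`). -/
theorem typedCount_symKer [LinearOrder R] [IsStrictOrderedRing R] (F : Finset E) (z : Config E)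
    (τ : E → ℕ) (hτ : ∀ e ∈ F, τ e = 1 ∨ τ e = 2) (K : Config E → Config E → Config E → R) :
    typedCount F z τ (symKer K) = typedCount F z τ K := by
  have h := typedCount_const_mul' F z τ (6 : R)⁻¹
    (fun x y w => K x y w + K x w y + K y x w + K y w x + K w x y + K w y x)
  have hs : typedCount F z τ (symKer K) = typedCount F z τ
      (fun x y w => (6 : R)⁻¹ * (K x y w + K x w y + K y x w + K y w x + K w x y + K w y x)) := rfl
  rw [hs, h, typedCount_sum6 F z τ K (fun x y w => K x w y) (fun x y w => K y x w)
    (fun x y w => K y w x) (fun x y w => K w x y) (fun x y w => K w y x),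
    TypedA3.typedCount_swap23 F z τ hτ K, TypedA3.typedCount_swap12 F z τ K,
    typedCount_cyc F z τ hτ K, typedCount_cyc' F z τ hτ K, TypedA3.typedCount_swap13 F z τ hτ K]
  have h6 : (6 : R) ≠ 0 := by norm_num
  field_simp
  ring

end Sym

/-! ## Class sums: the typed count with a colouring of `S` fixed -/

section Classes

variable {E : Type*} [Fintype E] [DecidableEq E] {R : Type*} [Field R]

/-- The **class sum**: the typed count restricted to the typed triples agreeing with the colouring
`(x₀, y₀, w₀)` on the edges of `S`. -/
def typedClassCount (F : Finset E) (z : Config E) (τ : E → ℕ) (S : Finset E) (x₀ y₀ w₀ : Config E)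
    (K : Config E → Config E → Config E → R) : R :=
  ∑ x : Config E, ∑ y : Config E, ∑ w : Config E,
    if ((∀ e, e ∉ F → x e = z e ∧ y e = z e ∧ w e = z e) ∧ (∀ e ∈ F, openCount x y w e = τ e)) ∧
        (∀ e ∈ S, x e = x₀ e ∧ y e = y₀ e ∧ w e = w₀ e)
      then K x y w else 0

/-- With nothing fixed the class sum is the typed count. -/
lemma typedClassCount_empty (F : Finset E) (z : Config E) (τ : E → ℕ) (x₀ y₀ w₀ : Config E)
    (K : Config E → Config E → Config E → R) :
    typedClassCount F z τ ∅ x₀ y₀ w₀ K = typedCount F z τ K := by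
  unfold typedClassCount typedCount
  simp only [Finset.notMem_empty, false_implies, implies_true, and_true]

/-- The restriction of a configuration to `S` (closed off `S`). -/
def restrict (S : Finset E) (x : Config E) : Config E := fun e => if e ∈ S then x e else false

omit [Fintype E] in
/-- A colouring that is closed off `S` and agrees with `(x, y, w)` on `S` is the restriction of
`(x, y, w)`. -/
lemma eq_restrict_of_pad_agree {S : Finset E} {x y w x₀ y₀ w₀ : Config E}
    (hp : ∀ e, e ∉ S → x₀ e = false ∧ y₀ e = false ∧ w₀ e = false)
    (ha : ∀ e ∈ S, x e = x₀ e ∧ y e = y₀ e ∧ w e = w₀ e) :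
    x₀ = restrict S x ∧ y₀ = restrict S y ∧ w₀ = restrict S w := by
  refine ⟨funext fun e => ?_, funext fun e => ?_, funext fun e => ?_⟩ <;>
    by_cases he : e ∈ S
  · simp [restrict, he, (ha e he).1]
  · simp [restrict, he, (hp e he).1]
  · simp [restrict, he, (ha e he).2.1]
  · simp [restrict, he, (hp e he).2.1]
  · simp [restrict, he, (ha e he).2.2]
  · simp [restrict, he, (hp e he).2.2]

omit [Fintype E] in
/-- The restriction is closed off `S`. -/
lemma restrict_pad (S : Finset E) (x y w : Config E) :
    ∀ e, e ∉ S → restrict S x e = false ∧ restrict S y e = false ∧ restrict S w e = false := by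
  intro e he
  simp [restrict, he]

omit [Fintype E] in
/-- A triple agrees with its restriction on `S`. -/
lemma restrict_agree (S : Finset E) (x y w : Config E) :
    ∀ e ∈ S, x e = restrict S x e ∧ y e = restrict S y e ∧ w e = restrict S w e := by
  intro e he
  simp [restrict, he]

/-- Exactly one colouring of `S` (padded by `false` off `S`) agrees with a given triple on `S`. -/
lemma sum_pad_agree (S : Finset E) (x y w : Config E) (c : R) :
    (∑ x₀ : Config E, ∑ y₀ : Config E, ∑ w₀ : Config E,
      if (∀ e, e ∉ S → x₀ e = false ∧ y₀ e = false ∧ w₀ e = false) ∧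
          (∀ e ∈ S, x e = x₀ e ∧ y e = y₀ e ∧ w e = w₀ e) then c else 0) = c := by
  rw [Finset.sum_eq_single (restrict S x)]
  · rw [Finset.sum_eq_single (restrict S y)]
    · rw [Finset.sum_eq_single (restrict S w)]
      · rw [if_pos ⟨restrict_pad S x y w, restrict_agree S x y w⟩]
      · intro w₀ _ hne
        rw [if_neg]
        rintro ⟨hp, ha⟩
        exact hne (eq_restrict_of_pad_agree hp ha).2.2
      · intro h; exact absurd (Finset.mem_univ _) h
    · intro y₀ _ hne
      refine Finset.sum_eq_zero fun w₀ _ => ?_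
      rw [if_neg]
      rintro ⟨hp, ha⟩
      exact hne (eq_restrict_of_pad_agree hp ha).2.1
    · intro h; exact absurd (Finset.mem_univ _) h
  · intro x₀ _ hne
    refine Finset.sum_eq_zero fun y₀ _ => Finset.sum_eq_zero fun w₀ _ => ?_
    rw [if_neg]
    rintro ⟨hp, ha⟩
    exact hne (eq_restrict_of_pad_agree hp ha).1
  · intro h; exact absurd (Finset.mem_univ _) h

omit [Fintype E] [DecidableEq E] in
/-- Two triply nested sums commute. -/
lemma sum3_comm {α β γ α' β' γ' : Type*} [Fintype α] [Fintype β] [Fintype γ] [Fintype α']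
    [Fintype β'] [Fintype γ'] (f : α → β → γ → α' → β' → γ' → R) :
    (∑ a : α, ∑ b : β, ∑ c : γ, ∑ x : α', ∑ y : β', ∑ w : γ', f a b c x y w) =
      ∑ x : α', ∑ y : β', ∑ w : γ', ∑ a : α, ∑ b : β, ∑ c : γ, f a b c x y w := by
  have h := Finset.sum_comm (s := (Finset.univ : Finset (α × β × γ)))
    (t := (Finset.univ : Finset (α' × β' × γ')))
    (f := fun (q : α × β × γ) (p : α' × β' × γ') => f q.1 q.2.1 q.2.2 p.1 p.2.1 p.2.2)
  simpa only [Fintype.sum_prod_type] using h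

/-- **The classes partition the typed triples**: the typed count is the sum, over the colourings of
`S` (padded by `false` off `S`), of the class sums. -/
theorem typedCount_eq_sum_typedClassCount (F : Finset E) (z : Config E) (τ : E → ℕ) (S : Finset E)
    (K : Config E → Config E → Config E → R) :
    typedCount F z τ K =
      ∑ x₀ : Config E, ∑ y₀ : Config E, ∑ w₀ : Config E,
        if (∀ e, e ∉ S → x₀ e = false ∧ y₀ e = false ∧ w₀ e = false)
          then typedClassCount F z τ S x₀ y₀ w₀ K else 0 := by
  have h1 : ∀ x₀ y₀ w₀ : Config E,
      (if (∀ e, e ∉ S → x₀ e = false ∧ y₀ e = false ∧ w₀ e = false)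
        then typedClassCount F z τ S x₀ y₀ w₀ K else 0) =
      ∑ x : Config E, ∑ y : Config E, ∑ w : Config E,
        if (∀ e, e ∉ S → x₀ e = false ∧ y₀ e = false ∧ w₀ e = false) ∧
            (((∀ e, e ∉ F → x e = z e ∧ y e = z e ∧ w e = z e) ∧
              (∀ e ∈ F, openCount x y w e = τ e)) ∧
            (∀ e ∈ S, x e = x₀ e ∧ y e = y₀ e ∧ w e = w₀ e))
          then K x y w else 0 := by
    intro x₀ y₀ w₀
    unfold typedClassCount
    by_cases hp : ∀ e, e ∉ S → x₀ e = false ∧ y₀ e = false ∧ w₀ e = false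
    · rw [if_pos hp]
      simp only [eq_true hp, true_and]
    · rw [if_neg hp]
      symm
      refine Finset.sum_eq_zero fun x _ => Finset.sum_eq_zero fun y _ =>
        Finset.sum_eq_zero fun w _ => ?_
      rw [if_neg]
      exact fun h => hp h.1
  simp only [h1]
  rw [sum3_comm]
  unfold typedCount
  refine Finset.sum_congr rfl fun x _ => Finset.sum_congr rfl fun y _ =>
    Finset.sum_congr rfl fun w _ => ?_
  by_cases ht : (∀ e, e ∉ F → x e = z e ∧ y e = z e ∧ w e = z e) ∧
      (∀ e ∈ F, openCount x y w e = τ e)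
  · rw [if_pos ht]
    simp only [eq_true ht, true_and]
    exact (sum_pad_agree S x y w (K x y w)).symm
  · rw [if_neg ht]
    symm
    refine Finset.sum_eq_zero fun x₀ _ => Finset.sum_eq_zero fun y₀ _ =>
      Finset.sum_eq_zero fun w₀ _ => ?_
    rw [if_neg]
    exact fun h => ht h.2.1

end Classes

/-! ## The statement (TRI-o) -/

section TriO

variable {V : Type*} {E : Type*} [Fintype E] [DecidableEq E] [DecidableEq V]
  {R : Type*} [Field R] [LinearOrder R] [IsStrictOrderedRing R]

/-- **(TRI-o)**, night-3 g15's candidate (STATUS 7700): for every instance `(F, z, τ)` with types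
in `{1, 2}` on the typed edges and every colouring `(x₀, y₀, w₀)` of the typed edges at `o`, the
class sum of the symmetrised kernel `symKer K₃` is nonnegative.  Census-true at `a ≤ 5` on the
abstract merge model (0 negative classes); NOT claimed proved. -/
def TypedBasesO (ends : E → Sym2 V) (o a₁ a₂ a₃ b : V) : Prop :=
  ∀ (F : Finset E) (z : Config E) (τ : E → ℕ), (∀ e ∈ F, τ e = 1 ∨ τ e = 2) →
    ∀ x₀ y₀ w₀ : Config E,
      0 ≤ typedClassCount F z τ (F.filter fun e => o ∈ ends e) x₀ y₀ w₀
        (symKer (K3 ends o a₁ a₂ a₃ b : Config E → Config E → Config E → R))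

/-- **(TRI-o) strengthens row 2′TRI**: the typed bases of `K₃` are nonnegative as soon as every
class sum of `symKer K₃` with the `o`-star colouring fixed is (sum the classes, then drop the
symmetrisation). -/
theorem TypedBases_of_typedBasesO (ends : E → Sym2 V) (o a₁ a₂ a₃ b : V)
    (h : TypedBasesO (R := R) ends o a₁ a₂ a₃ b) : TypedBases (R := R) ends o a₁ a₂ a₃ b := by
  intro F z τ hτ
  rw [← typedCount_symKer F z τ hτ,
    typedCount_eq_sum_typedClassCount F z τ (F.filter fun e => o ∈ ends e)]
  refine Finset.sum_nonneg fun x₀ _ => Finset.sum_nonneg fun y₀ _ =>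
    Finset.sum_nonneg fun w₀ _ => ?_
  split_ifs
  · exact h F z τ hτ x₀ y₀ w₀
  · exact le_rfl

end TriO

end CovForm

end Summit.Ventures.PercRepro2
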